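import Mathlib
import Summits.Ventures.PercRepro2.HCov
import Summits.Ventures.PercRepro2.IsolatedMark
import Summits.Ventures.PercRepro2.GcSkelRules
import Summits.Ventures.PercRepro2.GcSkelReduction
import Summits.Ventures.PercRepro2.GcSkelReductionP
import Summits.Ventures.PercRepro2.GcSkelReductionI
import Summits.Ventures.PercRepro2.GcBlockConn
import Summits.Ventures.PercRepro2.GcBlock
import Summits.Ventures.PercRepro2.GcSkelReductionT

/-!
# The size-bounded reduction to the residual `WReducedT` (blind cell PercRepro2, typer-1 g56)

`GcSkelReductionT.HCov_of_wredT_of_base` proves (HCOV) on every graph from (HCOV) on the residual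
`WReducedT` by strong induction on `nonLoopCard`, with the residual hypothesis taken globally.
Folding a further REDUCTION (a move that lowers `nonLoopCard`) into the class of record needs the
same induction with the residual hypothesis available only up to the size at hand — a reduced
instance is an arbitrary smaller graph, for which the induction hypothesis, not the residual
hypothesis, must answer. This file states the lane's induction in that form:

* **`HCovWRedT_le R N`** — (HCOV) on the `WReducedT` instances with at most `N` non-loop edges;
* **`HCov_of_wredT_of_base_le`** — the induction of `HCov_of_wredT_of_base` verbatim, the bound
  threaded (every move lowers `nonLoopCard`, so an instance with at most `N` non-loop edges never
  asks for a residual instance with more);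
* **`HCov_of_HCovWRedT_le`** — (HCOV) on every graph with at most `N` non-loop edges follows from
  `HCovWRedT_le R N`.

With it a reduction step folds into the class of record in a few lines (`GcSkelReductionZ.lean`:
the root edge at `a₃`), and so does every further one.
-/

namespace Summit.Ventures.PercRepro2

open CovForm Contract RECM CutVertexM9 SepPair

namespace WRed

/-! ## The size-bounded reduction to `WReducedT` -/

section BoundedClosure

variable (R : Type*) [Field R] [LinearOrder R] [IsStrictOrderedRing R]

/-- **(HCOV) on the residual `WReducedT` with at most `N` non-loop edges.** -/
def HCovWRedT_le (N : ℕ) : Prop :=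
  ∀ (V E : Type) [Fintype V] [DecidableEq V] [Fintype E] [DecidableEq E]
    (ends : E → Sym2 V), nonLoopCard ends ≤ N → ∀ (p : E → R), IsProbVec p →
    ∀ o a₁ a₂ a₃ b : V, a₁ ≠ a₂ → a₁ ≠ a₃ → a₂ ≠ a₃ → o ≠ a₁ → o ≠ a₂ → o ≠ a₃ → o ≠ b →
      b ≠ a₁ → b ≠ a₂ → b ≠ a₃ → WReducedT ends o a₁ a₂ a₃ b → HCov p ends o a₁ a₂ a₃ b

end BoundedClosure

section BoundedMain

variable {R : Type*} [Field R] [LinearOrder R] [IsStrictOrderedRing R]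

/-- **The bounded reduction to the residual with no collapsible block**: the strong induction of
`GcSkelReductionT.HCov_of_wredT_of_base` with the base hypothesis needed only up to the bound
`N` — every move lowers `nonLoopCard`, so an instance with at most `N` non-loop edges never asks
for a residual instance with more. The body is that induction verbatim, the bound threaded. -/
theorem HCov_of_wredT_of_base_le (N : ℕ) (hB : HCovWRedT_le R N) (n : ℕ) :
    n ≤ N → ∀ (V E : Type) [Fintype V] [DecidableEq V] [Fintype E] [DecidableEq E]
      (ends : E → Sym2 V), nonLoopCard ends = n → ∀ (p : E → R), IsProbVec p →
      ∀ o a₁ a₂ a₃ b : V, a₁ ≠ a₂ → a₁ ≠ a₃ → a₂ ≠ a₃ → o ≠ a₁ → o ≠ a₂ → o ≠ a₃ → o ≠ b →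
        b ≠ a₁ → b ≠ a₂ → b ≠ a₃ → HCov p ends o a₁ a₂ a₃ b := by
  induction n using Nat.strong_induction_on with
  | _ n ih =>
  intro hnN V E _ _ _ _ ends hn p hp o a₁ a₂ a₃ b h12 h13 h23 ho1 ho2 ho3 hob hb1 hb2 hb3
  have ih' : IHBelow R V E n := fun ends' hlt => ih _ hlt (le_trans hlt.le hnN) V E ends' rfl
  -- the block collapse: a mark-free two-terminal block is one edge (`GcBlock.lean`)
  by_cases hBlk : Block.HasBlock ends o a₁ a₂ a₃ b
  · exact Block.HCov_of_hasBlock hp (fun ends' hlt p' hp' => ih' ends' (hn ▸ hlt) p' hp' o a₁ a₂ a₃ b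
      h12 h13 h23 ho1 ho2 ho3 hob hb1 hb2 hb3) hBlk
  -- an isolated mark among `a₁, a₂, o, b` (p5 g24)
  by_cases hiso : IsolatedMark.IsIsolated ends a₁ ∨ IsolatedMark.IsIsolated ends a₂ ∨
      IsolatedMark.IsIsolated ends o ∨ IsolatedMark.IsIsolated ends b
  · exact IsolatedMark.HCov_isolated_mark p h12 h13 h23 ho1 ho2 hb1 hb2 hiso
  push Not at hiso
  by_cases hsimp : Simple ends
  swap
  · unfold Simple at hsimp
    push Not at hsimp
    obtain ⟨g₁, g₂, hg12, hnd, hpar⟩ := hsimp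
    obtain ⟨u, v, huv⟩ : ∃ u v, ends g₁ = s(u, v) :=
      (Sym2.exists (f := fun t => ends g₁ = t)).1 ⟨ends g₁, rfl⟩
    have hnd2 : ¬ (ends g₂).IsDiag := by rw [← hpar]; exact hnd
    unfold HCov
    rw [Gc_parallel p hg12 hpar.symm u o a₁ a₂ a₃ b]
    exact ih' _ (hn ▸ nonLoopCard_update_loop_lt ends hnd2 u) _ (isProbVec_parallel hp g₁ g₂)
      o a₁ a₂ a₃ b h12 h13 h23 ho1 ho2 ho3 hob hb1 hb2 hb3
  by_cases hun : ∃ y, Unmarked o a₁ a₂ a₃ b y ∧ (nonLoopDeg ends y = 1 ∨ nonLoopDeg ends y = 2)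
  · obtain ⟨y, hy, hd⟩ := hun
    rcases hd with h1 | h2
    · obtain ⟨e, x, he, hxy, hleaf⟩ := leaf_of_nonLoopDeg_one h1
      have hne : ¬ (ends e).IsDiag := by
        rw [he, Sym2.mk_isDiag_iff]
        exact hxy
      unfold HCov
      rw [Gc_leaf_at p he hxy hy hleaf]
      exact ih' _ (hn ▸ nonLoopCard_update_loop_lt ends hne x) p hp o a₁ a₂ a₃ b h12 h13 h23
        ho1 ho2 ho3 hob hb1 hb2 hb3
    · obtain ⟨e, f, x, w, hef, he, hf, hxy, hyw, hdeg⟩ := series_of_nonLoopDeg_two h2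
      unfold HCov
      rw [Gc_series_at p he hf hef hxy hyw hy hdeg]
      exact ih' _ (hn ▸ nonLoopCard_contract_lt ends hxy he) _ (isProbVec_series hp e f)
        o a₁ a₂ a₃ b h12 h13 h23 ho1 ho2 ho3 hob hb1 hb2 hb3
  by_cases hdo : nonLoopDeg ends o = 1
  · exact HCov_of_o_leaf ih' ends hn p hp o a₁ a₂ a₃ b h12 h13 h23 ho1 ho2 ho3 hob hb1 hb2 hb3
      hdo
  by_cases hdb : nonLoopDeg ends b = 1
  · exact HCov_of_b_leaf ih' ends hn p hp o a₁ a₂ a₃ b h12 h13 h23 ho1 ho2 ho3 hob hb1 hb2 hb3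
      hdb
  by_cases h3 : ∃ (e : E) (x : V), ends e = s(x, a₃) ∧ x ≠ a₃ ∧ nonLoopDeg ends a₃ = 1 ∧
      ¬ Unmarked o a₁ a₂ a₃ b x
  · obtain ⟨e, x, he, hx, hd, hm⟩ := h3
    exact HCov_of_a3_leaf_marked ends p hp o a₁ a₂ a₃ b h13 h23 ho3 hb3 hd ⟨e, x, he, hx, hm⟩
  by_cases h1 : ∃ (e : E) (x : V), ends e = s(x, a₁) ∧ x ≠ a₁ ∧ nonLoopDeg ends a₁ = 1 ∧
      ¬ Unmarked o a₁ a₂ a₃ b x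
  · obtain ⟨e, x, he, hx, hd, hm⟩ := h1
    exact HCov_of_a1_leaf_marked ends p hp o a₁ a₂ a₃ b h12 h13 ho1 hb1 hd ⟨e, x, he, hx, hm⟩
  by_cases h2 : ∃ (e : E) (x : V), ends e = s(x, a₂) ∧ x ≠ a₂ ∧ nonLoopDeg ends a₂ = 1 ∧
      ¬ Unmarked o a₁ a₂ a₃ b x
  · obtain ⟨e, x, he, hx, hd, hm⟩ := h2
    exact HCov_of_a2_leaf_marked ends p hp o a₁ a₂ a₃ b h12 h23 ho2 hb2 hd ⟨e, x, he, hx, hm⟩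
  push Not at h1 h2
  -- a pendant `a₁` at an unmarked vertex: contract it (p5 g24)
  by_cases hd1 : nonLoopDeg ends a₁ = 1
  · obtain ⟨ends₁, e, x, h₁e, hx1, hleaf₁, hagree, hagree', he, -⟩ := exists_relocated hd1
    have hx : Unmarked o a₁ a₂ a₃ b x := h1 e x he hx1 hd1
    have hGc : Gc p ends o a₁ a₂ a₃ b = Gc p ends₁ o a₁ a₂ a₃ b :=
      Gc_eq_of_agree_nonLoop p hagree hagree' o a₁ a₂ a₃ b
    have hcard : nonLoopCard ends₁ ≤ n := hn ▸ nonLoopCard_le_of_agree hagree'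
    have hf₁ : ends₁ e = s(a₁, x) := by rw [h₁e, Sym2.eq_swap]
    unfold HCov
    rw [hGc]
    refine LeafRoot.HCov_pendant_root_contract' p hp hf₁ hleaf₁ hx ho1 h12.symm h13.symm hb1 ?_
    have hlt := lt_of_lt_of_le (nonLoopCard_contract_lt ends₁ hx1.symm hf₁) hcard
    exact ih _ hlt (le_trans hlt.le hnN) V E _ rfl p hp
      o a₁ a₂ a₃ b h12 h13 h23 ho1 ho2 ho3 hob hb1 hb2 hb3
  -- a pendant `a₂` at an unmarked vertex: contract it (p5 g24)
  by_cases hd2 : nonLoopDeg ends a₂ = 1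
  · obtain ⟨ends₁, e, x, h₁e, hx2, hleaf₁, hagree, hagree', he, -⟩ := exists_relocated hd2
    have hx : Unmarked o a₁ a₂ a₃ b x := h2 e x he hx2 hd2
    have hGc : Gc p ends o a₁ a₂ a₃ b = Gc p ends₁ o a₁ a₂ a₃ b :=
      Gc_eq_of_agree_nonLoop p hagree hagree' o a₁ a₂ a₃ b
    have hcard : nonLoopCard ends₁ ≤ n := hn ▸ nonLoopCard_le_of_agree hagree'
    have hf₁ : ends₁ e = s(a₂, x) := by rw [h₁e, Sym2.eq_swap]
    unfold HCov
    rw [hGc]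
    refine LeafRoot.HCov_pendant_root_contract p hp hf₁ hleaf₁ hx ho2 h12 h23.symm hb2 ?_
    have hlt := lt_of_lt_of_le (nonLoopCard_contract_lt ends₁ hx2.symm hf₁) hcard
    exact ih _ hlt (le_trans hlt.le hnN) V E _ rfl p hp
      o a₁ a₂ a₃ b h12 h13 h23 ho1 ho2 ho3 hob hb1 hb2 hb3
  -- the cut-vertex moves
  by_cases hP : ∃ (side : E → Bool) (L : Set V) (v : V) (Rt : Set V) (g : E),
      CutVertex ends side L v Rt ∧ (∀ m ∈ ({o, a₁, a₂, a₃, b} : Set V), m ∈ Rt ∨ m = v) ∧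
      side g = true ∧ ¬ (ends g).IsDiag
  · obtain ⟨side, L, v, Rt, g, h, hM, hg, hgd⟩ := hP
    have hlt : nonLoopCard (CutPrune.rends ends side) < n := hn ▸ nonLoopCard_prune_lt hg hgd
    exact CutPrune.HCov_of_right h p o a₁ a₂ a₃ b hM
      (ih _ hlt (le_trans hlt.le hnN) V _ (CutPrune.rends ends side) rfl _
        (CutPrune.isProbVec_rweights hp) o a₁ a₂ a₃ b h12 h13 h23 ho1 ho2 ho3 hob hb1 hb2 hb3)
  by_cases hO : ∃ (side : E → Bool) (L : Set V) (v : V) (Rt : Set V) (w : V),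
      CutVertex ends side L v Rt ∧ w ∈ L ∧
      (∀ m ∈ ({o, a₁, a₂, a₃, b} : Set V), m = w ∨ m ∈ Rt ∨ m = v) ∧ 1 < leftCard ends side
  · obtain ⟨side, L, v, Rt, w, h, hw, hM, hlt⟩ := hO
    obtain ⟨g₁, hg₁, g₂, hg₂, hne⟩ := Finset.one_lt_card.1 hlt
    rw [Finset.mem_filter] at hg₁ hg₂
    have hlt' : nonLoopCard (CutOneFar.rends ends side v w) < n :=
      hn ▸ nonLoopCard_oneFar_lt v w hne hg₁.2.1 hg₁.2.2 hg₂.2.1 hg₂.2.2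
    exact CutOneFar.HCov_of_reduced h hw p o a₁ a₂ a₃ b hM
      (ih _ hlt' (le_trans hlt'.le hnN) V _ (CutOneFar.rends ends side v w) rfl _
        (CutOneFar.isProbVec_rweights_leftProb ends side v w hp) o a₁ a₂ a₃ b h12 h13 h23 ho1
        ho2 ho3 hob hb1 hb2 hb3)
  by_cases hT : ∃ (side : E → Bool) (L : Set V) (v : V) (Rt : Set V),
      CutVertex ends side L v Rt ∧ TwoThree L v Rt o a₁ a₂ a₃ b
  · obtain ⟨side, L, v, Rt, h, htt⟩ := hT
    exact CutTwoFar.HCov_cut_twoLeft h hp htt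
  -- the class theorems
  by_cases hR : RootsToMarks ends o a₁ a₂ a₃ b
  · exact HubAll.HCovR_all_holds V E ends p hp o a₁ a₂ a₃ b h12 h13 h23 ho1 ho2 ho3 hob hb1 hb2
      hb3 hR
  by_cases hR3 : A3RECM.A3ToMarks ends o a₁ a₂ a₃ b
  · exact HubAll.HCovR3_all_holds V E ends p hp o a₁ a₂ a₃ b h12 h13 h23 ho1 ho2 ho3 hob hb1 hb2
      hb3 hR3
  by_cases hPk : ∃ P : Finset V, PocketConn.IsPocket ends (↑P : Set V) a₁ a₂ ∧ a₃ ∈ P ∧ a₁ ∉ P ∧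
      a₂ ∉ P ∧ o ∉ P ∧ b ∉ P
  · obtain ⟨P, hPk, h3', h1', h2', ho', hb'⟩ := hPk
    exact PocketConn.HCov_pocket p hp hPk h12 h1' h2' ho' hb' h3'
  by_cases hs2 : b ∈ cluster ends (sepConfig ends {a₁, a₂}) o
  swap
  · unfold HCov
    rw [SepTwoGcZero.Gc_eq_zero_of_sepPair hp ends a₃ b (by simp [ho1, ho2]) hs2]
  by_cases hs3 : a₂ ∉ cluster ends (sepConfig ends {a₁, a₃}) o ∪ {a₁, a₃} ∧
      b ∉ cluster ends (sepConfig ends {a₁, a₃}) o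
  · unfold HCov
    rw [SepThreeGcZero.Gc_eq_zero_of_sepThree hp ends (by simp [ho1, ho3]) hs3.1 hs3.2]
  by_cases hs3' : a₁ ∉ cluster ends (sepConfig ends {a₂, a₃}) o ∪ {a₂, a₃} ∧
      b ∉ cluster ends (sepConfig ends {a₂, a₃}) o
  · unfold HCov
    rw [SepThreeGcZero.Gc_eq_zero_of_sepThree' hp ends (by simp [ho2, ho3]) hs3'.1 hs3'.2]
  by_cases hN : ∃ (q : Fin 5 → V) (blk : E → Fin 5) (Vj : Fin 5 → Set V),
      Cycle.IsNecklace ends q blk Vj ∧ ∃ ko k₁ k₂ k₃ kb : Fin 5, ko ≠ k₁ ∧ ko ≠ k₂ ∧ ko ≠ k₃ ∧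
      ko ≠ kb ∧ k₁ ≠ k₂ ∧ k₁ ≠ k₃ ∧ k₁ ≠ kb ∧ k₂ ≠ k₃ ∧ k₂ ≠ kb ∧ k₃ ≠ kb ∧
      q ko = o ∧ q k₁ = a₁ ∧ q k₂ = a₂ ∧ q k₃ = a₃ ∧ q kb = b
  · obtain ⟨q, blk, Vj, hNk, ko, k₁, k₂, k₃, kb, h01, h02, h03, h04, h12', h13', h14, h23', h24,
      h34, rfl, rfl, rfl, rfl, rfl⟩ := hN
    exact Cycle.HCov_necklace hNk p hp ko k₁ k₂ k₃ kb h01 h02 h03 h04 h12' h13' h14 h23' h24 h34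
  by_cases h5 : BlockSubst.FiveTerminalClass ends o a₁ a₂ a₃ b
  · exact BlockSubst.HCov_of_fiveTerminalClass ends o a₁ a₂ a₃ b h5 p hp
  by_cases h6 : BlockSubst.SixTerminalClass ends o a₁ a₂ a₃ b
  · exact BlockSubst.HCov_of_sixTerminalClass ends o a₁ a₂ a₃ b h6 p hp
  by_cases h7 : Seven.SevenSkelClass ends o a₁ a₂ a₃ b
  · exact Seven.HCov_of_sevenSkelClass ends o a₁ a₂ a₃ b h7 p hp
  by_cases h7' : Seven.SevenSkelClass ends o a₂ a₁ a₃ b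
  · exact Seven.HCov_of_sevenSkelClass' ends o a₁ a₂ a₃ b h7' p hp
  -- the residual with no collapsible block
  push Not at hun h3 hP hO hT hPk hs3 hs3' hN
  exact hB V E ends (hn ▸ hnN) p hp o a₁ a₂ a₃ b h12 h13 h23 ho1 ho2 ho3 hob hb1 hb2 hb3
    ⟨⟨⟨⟨⟨⟨⟨⟨⟨⟨hsimp, hun, hdo, hdb⟩, h3, h1, h2⟩, hP, hO, hT⟩, hR, hR3, hPk, hs2, hs3, hs3'⟩, hN⟩,
      h5, h6⟩, h7, h7'⟩, hd1, hd2⟩, hiso.1, hiso.2.1, hiso.2.2.1, hiso.2.2.2⟩, hBlk⟩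

/-- **The bounded reduction**: (HCOV) on every graph with at most `N` non-loop edges follows from
(HCOV) on the `WReducedT` instances with at most `N` non-loop edges. -/
theorem HCov_of_HCovWRedT_le (N : ℕ) (hB : HCovWRedT_le R N) :
    ∀ (V E : Type) [Fintype V] [DecidableEq V] [Fintype E] [DecidableEq E] (ends : E → Sym2 V),
      nonLoopCard ends ≤ N → ∀ (p : E → R), IsProbVec p →
      ∀ o a₁ a₂ a₃ b : V, a₁ ≠ a₂ → a₁ ≠ a₃ → a₂ ≠ a₃ → o ≠ a₁ → o ≠ a₂ → o ≠ a₃ → o ≠ b →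
        b ≠ a₁ → b ≠ a₂ → b ≠ a₃ → HCov p ends o a₁ a₂ a₃ b :=
  fun V E _ _ _ _ ends hle p hp o a₁ a₂ a₃ b h12 h13 h23 ho1 ho2 ho3 hob hb1 hb2 hb3 =>
    HCov_of_wredT_of_base_le N hB _ hle V E ends rfl p hp o a₁ a₂ a₃ b h12 h13 h23 ho1 ho2 ho3
      hob hb1 hb2 hb3

end BoundedMain

end WRed

end Summit.Ventures.PercRepro2
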